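import Summits.CriticalPhenomena.Ising3DConformalLimit.Theorems.ReflectionTwinExistsContinuousLimitFoldChain
import HarnessLib

/-!
# Item 6150 `TwoPointDoubling` ⟺ ANGULAR COMPARABILITY on the two Messager–Miracle-Solé spheres; each free-box deficit delivers one sphere

Crux `ExistsContinuousLimit` (item stmt-CriticalPhenomena-4582), line `free-box-deficit` (lead c5). The Messager–Miracle-Solé sandwich
`g(2n) ≤ Gd(n) ≤ g(n)` (`g(n) = G(ne₀)`, `Gd(n) = G(n,n,0)`, `G = criticalTwoPoint 3`) makes item 6150 (all-scale axial doubling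
`g(2n) ≥ κ g(n)`) EQUIVALENT to the conjunction of two one-scale, two-direction comparabilities:

* sup-sphere comparability `Gd(n) ≥ κ₁ g(n)` (the diagonal point of the sup-sphere of radius `n` against its pole), and
* `ℓ¹`-sphere comparability `g(2n) ≥ κ₂ Gd(n)` (the pole of the `ℓ¹`-sphere of radius `2n` against its face centre)

(`twoPointDoubling_iff_angular`, the card's "funnel form" of 6150). The two landed fold chains (p163440) show that EACH free-box
deficit of the line delivers exactly ONE of the two: the axis deficit gives sup-sphere comparability with `κ₁ = c₁/6`
(`supSphere_of_axisBoxDeficit`), the diagonal deficit gives `ℓ¹` comparability with `κ₂ = c₂/6` (`l1Sphere_of_diagBoxDeficit`).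
References: A. Messager, S. Miracle-Solé, J. Stat. Phys. 17 (1977) 245 (through `ReflectionTwinExistsContinuousLimitMmsFaces`).
-/

noncomputable section

namespace Summit.CriticalPhenomena.Ising3DConformalLimit.ReflectionTwinExistsContinuousLimit.FreeBox

open Finset Filter
open scoped BigOperators
open Literature.Probability.LatticeModels
open Summit.CriticalPhenomena.Ising3DConformalLimit.Theses
open Classical

/-- `(n,n,0)` in `![…]` form. [folklore] -/
theorem diagPt_eq (n : ℕ) : (Pi.single 0 (n : ℤ) + Pi.single 1 (n : ℤ) : Site 3) = ![(n : ℤ), n, 0] := by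
  funext j; fin_cases j <;> simp

/-- `m e₀` in `![…]` form. [folklore] -/
theorem axisPt_eq (m : ℤ) : (Pi.single 0 m : Site 3) = ![m, 0, 0] := by
  funext j; fin_cases j <;> simp

/-- **MMS, `ℓ¹` side: `g(2n) ≤ Gd(n)`** (diagonal Messager–Miracle-Solé, `n` steps from `(n,n,0)` to `(2n,0,0)`).
[cite: MessagerMiracleSoleJSP1977, main theorem] -/
theorem g_two_mul_le_Gd (n : ℕ) :
    criticalTwoPoint 3 (Pi.single 0 (2 * (n : ℤ))) ≤ criticalTwoPoint 3 (Pi.single 0 (n : ℤ) + Pi.single 1 (n : ℤ)) := by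
  rw [diagPt_eq, axisPt_eq]
  have h := mms_diag_iter (a := (n : ℤ)) (b := (n : ℤ)) le_rfl 0 n
  have e1 : (n : ℤ) + n = 2 * n := by ring
  have e2 : (n : ℤ) - n = 0 := by ring
  rwa [e1, e2] at h

/-- **MMS, sup side: `Gd(n) ≤ g(n)`** (coordinate Messager–Miracle-Solé in direction `1`, `n` steps from `(n,0,0)` to `(n,n,0)`).
[cite: MessagerMiracleSoleJSP1977, main theorem] -/
theorem Gd_le_g (n : ℕ) :
    criticalTwoPoint 3 (Pi.single 0 (n : ℤ) + Pi.single 1 (n : ℤ)) ≤ criticalTwoPoint 3 (Pi.single 0 (n : ℤ)) := by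
  rw [diagPt_eq, axisPt_eq]
  have h := mms_one_iter (n : ℤ) (b := 0) le_rfl 0 n
  rwa [zero_add] at h

/-- **Item 6150 ⟺ angular comparability on the two MMS spheres.** [folklore] -/
theorem twoPointDoubling_iff_angular : Summit.CriticalPhenomena.Ising3DConformalLimit.Theses.MirrorHoelderCompactness.TwoPointDoubling ↔ ((∃ κ : ℝ, 0 < κ ∧ ∀ n : ℕ, 1 ≤ n → κ * Literature.Probability.LatticeModels.criticalTwoPoint 3 (Pi.single 0 (n : ℤ)) ≤ Literature.Probability.LatticeModels.criticalTwoPoint 3 (Pi.single 0 (n : ℤ) + Pi.single 1 (n : ℤ))) ∧ (∃ κ : ℝ, 0 < κ ∧ ∀ n : ℕ, 1 ≤ n → κ * Literature.Probability.LatticeModels.criticalTwoPoint 3 (Pi.single 0 (n : ℤ) + Pi.single 1 (n : ℤ)) ≤ Literature.Probability.LatticeModels.criticalTwoPoint 3 (Pi.single 0 (2 * (n : ℤ))))) := by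
  constructor
  · rintro ⟨κ, hκ, h⟩
    refine ⟨⟨κ, hκ, fun n hn => (h n hn).trans (g_two_mul_le_Gd n)⟩, ⟨κ, hκ, fun n hn => ?_⟩⟩
    have h1 := h n hn
    have h2 := Gd_le_g n
    nlinarith [hκ.le]
  · rintro ⟨⟨κ₁, hκ₁, h₁⟩, ⟨κ₂, hκ₂, h₂⟩⟩
    refine ⟨κ₂ * κ₁, by positivity, fun n hn => ?_⟩
    have a := h₁ n hn
    have b := h₂ n hn
    have : κ₂ * (κ₁ * criticalTwoPoint 3 (Pi.single 0 (n : ℤ))) ≤ κ₂ * criticalTwoPoint 3 (Pi.single 0 (n : ℤ) + Pi.single 1 (n : ℤ)) :=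
      mul_le_mul_of_nonneg_left a hκ₂.le
    linarith

/-- **The axis deficit delivers sup-sphere comparability** with `κ₁ = c₁/6` (via the landed `axisFoldChain`). [folklore] -/
theorem supSphere_of_axisBoxDeficit
    (hA : ∃ c : ℝ, 0 < c ∧ ∀ n : ℕ, 1 ≤ n →
      isingTwoPoint (zdGraph 3)
          (Fintype.piFinset fun i : Fin 3 => Finset.Icc ((fun _ : Fin 3 => 1 - (((n + 1) / 2 : ℕ) : ℤ)) i)
            ((fun i : Fin 3 => if i = 0 then (n : ℤ) + (((n + 1) / 2 : ℕ) : ℤ) - 1 else (((n + 1) / 2 : ℕ) : ℤ) - 1) i))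
          (criticalBeta 3) 0 .free 0 (Pi.single 0 (n : ℤ)) ≤
        (1 - c) * criticalTwoPoint 3 (Pi.single 0 (n : ℤ))) :
    ∃ κ : ℝ, 0 < κ ∧ ∀ n : ℕ, 1 ≤ n →
      κ * criticalTwoPoint 3 (Pi.single 0 (n : ℤ)) ≤ criticalTwoPoint 3 (Pi.single 0 (n : ℤ) + Pi.single 1 (n : ℤ)) := by
  obtain ⟨c, hc, h⟩ := hA
  refine ⟨c / 6, by positivity, fun n hn => ?_⟩
  have e := axisFoldChain n hn
  have d := h n hn
  linarith

/-- **The diagonal deficit delivers `ℓ¹`-sphere comparability** with `κ₂ = c₂/6` (via the landed `diagFoldChain`). [folklore] -/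
theorem l1Sphere_of_diagBoxDeficit
    (hD : ∃ c : ℝ, 0 < c ∧ ∀ n : ℕ, 1 ≤ n →
      isingTwoPoint (zdGraph 3)
          (Fintype.piFinset fun i : Fin 3 => Finset.Icc ((fun i : Fin 3 => if i = 2 then 1 - (n : ℤ) else 1 - (((n + 1) / 2 : ℕ) : ℤ)) i)
            ((fun i : Fin 3 => if i = 2 then (n : ℤ) - 1 else (n : ℤ) + (((n + 1) / 2 : ℕ) : ℤ) - 1) i))
          (criticalBeta 3) 0 .free 0 (Pi.single 0 (n : ℤ) + Pi.single 1 (n : ℤ)) ≤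
        (1 - c) * criticalTwoPoint 3 (Pi.single 0 (n : ℤ) + Pi.single 1 (n : ℤ))) :
    ∃ κ : ℝ, 0 < κ ∧ ∀ n : ℕ, 1 ≤ n →
      κ * criticalTwoPoint 3 (Pi.single 0 (n : ℤ) + Pi.single 1 (n : ℤ)) ≤ criticalTwoPoint 3 (Pi.single 0 (2 * (n : ℤ))) := by
  obtain ⟨c, hc, h⟩ := hD
  refine ⟨c / 6, by positivity, fun n hn => ?_⟩
  have e := diagFoldChain n hn
  have d := h n hn
  linarith

end Summit.CriticalPhenomena.Ising3DConformalLimit.ReflectionTwinExistsContinuousLimit.FreeBox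

end
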